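import Summits.AtomisticToContinuum.FouriersLaw.Theorems.BondHeatUncertaintyExtensiveSnapshotIrreversibilityEnergyWindowDilationArrivalA1

/-!
# PART X-2A «DilationArrivalA»: calculus, the two-temperature orbit, the CEHR (3.4) root bound, integration by parts against a C¹ weight — part 2 of 2 (sequel of `…BondHeatUncertaintyExtensiveSnapshotIrreversibilityEnergyWindowDilationArrivalA1`)

Split for the 400-line cap by the landing lane (hand-2 g33); the module docstring of part 1 (`…BondHeatUncertaintyExtensiveSnapshotIrreversibilityEnergyWindowDilationArrivalA1`) describes the whole node.  Same namespace; all FQNs unchanged.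
0 sorry; standard axioms.
-/

noncomputable section

namespace Summit.AtomisticToContinuum.FouriersLaw.Theorems.ExtensiveSnapshotIrreversibility.EnergyWindow

open MeasureTheory Filter Topology Real Set Metric
open scoped ENNReal NNReal ContDiff
open Literature.MathematicalPhysics.KineticTheory.HeatConduction Literature.Probability.Process
open Literature.Analysis.FunctionSpaces

variable {N : ℕ}

/-! ## 4. Integration by parts against a `C¹` weight: the dilation and the truncated exchange -/

section ByParts

/-- **Dilation by parts**: for `h ∈ C¹_c` and `f ∈ C¹`,
`∫ f(y) · y_{p_b} ∂_{p_b}h(y) dy = −∫ h f − ∫ (h(y) y_{p_b}) ∂_{p_b}f(y) dy`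
(`∂_{p_b}(f p_b) = f + p_b ∂_{p_b}f`; no boundary terms). [folklore] -/
theorem integral_mul_momDilation_eq (b : Fin N) {h f : PhaseSpace N → ℝ} (hh : ContDiff ℝ 1 h)
    (hhc : HasCompactSupport h) (hf : ContDiff ℝ 1 f) :
    ∫ y, f y * momDilation b h y =
      -(∫ y, h y * f y) - ∫ y, (h y * y.2 b) * partialP b f y := by
  haveI := isAddHaarMeasure_volume_phaseSpace N
  set v : PhaseSpace N := ((0 : Fin N → ℝ), Pi.single b 1) with hv
  have hhd : Differentiable ℝ h := hh.differentiable one_ne_zero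
  have hfd : Differentiable ℝ f := hf.differentiable one_ne_zero
  have hmC : ContDiff ℝ 1 fun y : PhaseSpace N => y.2 b :=
    (contDiff_momentum_coord b).of_le (by exact_mod_cast le_top)
  have hmd : Differentiable ℝ fun y : PhaseSpace N => y.2 b := hmC.differentiable one_ne_zero
  -- the weight `g = f p_b`
  have hgC : ContDiff ℝ 1 fun y : PhaseSpace N => f y * y.2 b := hf.mul hmC
  have hgd : Differentiable ℝ fun y : PhaseSpace N => f y * y.2 b := hgC.differentiable one_ne_zero
  have hdg : Continuous fun y => fderiv ℝ (fun y : PhaseSpace N => f y * y.2 b) y v :=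
    (hgC.continuous_fderiv one_ne_zero).clm_apply continuous_const
  have hdh : Continuous fun y => fderiv ℝ h y v :=
    (hh.continuous_fderiv one_ne_zero).clm_apply continuous_const
  have hdhc : HasCompactSupport fun y => fderiv ℝ h y v := hhc.fderiv_apply (𝕜 := ℝ) v
  have e1 : (fun y => f y * momDilation b h y) =
      fun y => (f y * y.2 b) * fderiv ℝ h y v := by
    funext y
    simp only [momDilation]
    rw [partialP_eq_fderiv_apply b (hhd y)]
    ring
  have hibp := integral_mul_fderiv_eq_neg_fderiv_mul_of_integrable
    (μ := (volume : Measure (PhaseSpace N))) (f := fun y : PhaseSpace N => f y * y.2 b) (g := h)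
    (v := v)
    ((hdg.mul hh.continuous).integrable_of_hasCompactSupport hhc.mul_left)
    ((hgC.continuous.mul hdh).integrable_of_hasCompactSupport hdhc.mul_left)
    ((hgC.continuous.mul hh.continuous).integrable_of_hasCompactSupport hhc.mul_left)
    (fun y _ => hgd y) (fun y _ => hhd y)
  have e2 : ∀ y, fderiv ℝ (fun y : PhaseSpace N => f y * y.2 b) y v =
      f y + y.2 b * partialP b f y := fun y => by
    rw [← partialP_eq_fderiv_apply b (hgd y), partialP_fun_mul b (hfd y) (hmd y),
      partialP_momentum_coord, if_pos rfl]
    ring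
  rw [e1, hibp]
  have e3 : (fun y => fderiv ℝ (fun y : PhaseSpace N => f y * y.2 b) y v * h y) =
      fun y => h y * f y + (h y * y.2 b) * partialP b f y := by
    funext y
    rw [e2 y]
    ring
  have hf'c : Continuous (partialP b f) := continuous_partialP_of_contDiff b hf
  have i1 : Integrable (fun y => h y * f y) (volume : Measure (PhaseSpace N)) :=
    (hh.continuous.mul hf.continuous).integrable_of_hasCompactSupport hhc.mul_right
  have i2 : Integrable (fun y => (h y * y.2 b) * partialP b f y)
      (volume : Measure (PhaseSpace N)) :=
    ((hh.continuous.mul hmC.continuous).mul hf'c).integrable_of_hasCompactSupport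
      (hhc.mul_right.mul_right)
  rw [e3, integral_add i1 i2]
  ring

/-- **Truncated exchange by parts**: for a cutoff `χ ∈ C¹_c`, `u ∈ C¹`, a weight `f ∈ C¹` and a
coefficient `a = a(q) ∈ C¹` of the positions only (so that the field `p_b ∂_{q_b} + a ∂_{p_b}`
is divergence-free):
`∫ f χ (p_b ∂_{q_b}u + a ∂_{p_b}u) = −∫ u f (p_b ∂_{q_b}χ + a ∂_{p_b}χ) − ∫ (χ u p_b) ∂_{q_b}f
 − ∫ (χ u a) ∂_{p_b}f` (two applications of Mathlib's by-parts formula; `∂_{q_b} p_b = 0`,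
`∂_{p_b} a = 0`). [folklore] -/
theorem integral_mul_cutoff_exchange_eq (b : Fin N) {χ u f : PhaseSpace N → ℝ}
    {a : (Fin N → ℝ) → ℝ} (hχ : ContDiff ℝ 1 χ) (hχc : HasCompactSupport χ) (hu : ContDiff ℝ 1 u)
    (hf : ContDiff ℝ 1 f) (ha : ContDiff ℝ 1 a) :
    ∫ y, f y * (χ y * (y.2 b * partialQ b u y + a y.1 * partialP b u y)) =
      -(∫ y, u y * (f y * (y.2 b * partialQ b χ y + a y.1 * partialP b χ y))) -
        (∫ y, (χ y * (u y * y.2 b)) * partialQ b f y) -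
          ∫ y, (χ y * (u y * a y.1)) * partialP b f y := by
  haveI := isAddHaarMeasure_volume_phaseSpace N
  set vq : PhaseSpace N := ((Pi.single b 1, 0) : PhaseSpace N) with hvq
  set vp : PhaseSpace N := ((0 : Fin N → ℝ), Pi.single b 1) with hvp
  have hχd : Differentiable ℝ χ := hχ.differentiable one_ne_zero
  have hud : Differentiable ℝ u := hu.differentiable one_ne_zero
  have hfd : Differentiable ℝ f := hf.differentiable one_ne_zero
  have hmC : ContDiff ℝ 1 fun y : PhaseSpace N => y.2 b :=
    (contDiff_momentum_coord b).of_le (by exact_mod_cast le_top)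
  have hmd : Differentiable ℝ fun y : PhaseSpace N => y.2 b := hmC.differentiable one_ne_zero
  have haC : ContDiff ℝ 1 fun y : PhaseSpace N => a y.1 := ha.comp contDiff_fst
  have had : Differentiable ℝ fun y : PhaseSpace N => a y.1 := haC.differentiable one_ne_zero
  -- the two weights `g_q = χ p_b f`, `g_p = χ a f`
  have hgqC : ContDiff ℝ 1 fun y : PhaseSpace N => χ y * (y.2 b * f y) := hχ.mul (hmC.mul hf)
  have hgpC : ContDiff ℝ 1 fun y : PhaseSpace N => χ y * (a y.1 * f y) := hχ.mul (haC.mul hf)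
  have hgqd := hgqC.differentiable one_ne_zero
  have hgpd := hgpC.differentiable one_ne_zero
  have hgqc : HasCompactSupport fun y : PhaseSpace N => χ y * (y.2 b * f y) := hχc.mul_right
  have hgpc : HasCompactSupport fun y : PhaseSpace N => χ y * (a y.1 * f y) := hχc.mul_right
  have hdu : ∀ v : PhaseSpace N, Continuous fun y => fderiv ℝ u y v := fun v =>
    (hu.continuous_fderiv one_ne_zero).clm_apply continuous_const
  have hdgq : Continuous fun y => fderiv ℝ (fun y : PhaseSpace N => χ y * (y.2 b * f y)) y vq :=
    (hgqC.continuous_fderiv one_ne_zero).clm_apply continuous_const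
  have hdgp : Continuous fun y => fderiv ℝ (fun y : PhaseSpace N => χ y * (a y.1 * f y)) y vp :=
    (hgpC.continuous_fderiv one_ne_zero).clm_apply continuous_const
  -- the two integrations by parts
  have hq := integral_mul_fderiv_eq_neg_fderiv_mul_of_integrable
    (μ := (volume : Measure (PhaseSpace N))) (f := fun y : PhaseSpace N => χ y * (y.2 b * f y))
    (g := u) (v := vq)
    ((hdgq.mul hu.continuous).integrable_of_hasCompactSupport
      ((hgqc.fderiv_apply (𝕜 := ℝ) vq).mul_right))
    ((hgqC.continuous.mul (hdu vq)).integrable_of_hasCompactSupport hgqc.mul_right)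
    ((hgqC.continuous.mul hu.continuous).integrable_of_hasCompactSupport hgqc.mul_right)
    (fun y _ => hgqd y) (fun y _ => hud y)
  have hp' := integral_mul_fderiv_eq_neg_fderiv_mul_of_integrable
    (μ := (volume : Measure (PhaseSpace N))) (f := fun y : PhaseSpace N => χ y * (a y.1 * f y))
    (g := u) (v := vp)
    ((hdgp.mul hu.continuous).integrable_of_hasCompactSupport
      ((hgpc.fderiv_apply (𝕜 := ℝ) vp).mul_right))
    ((hgpC.continuous.mul (hdu vp)).integrable_of_hasCompactSupport hgpc.mul_right)
    ((hgpC.continuous.mul hu.continuous).integrable_of_hasCompactSupport hgpc.mul_right)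
    (fun y _ => hgpd y) (fun y _ => hud y)
  -- the derivatives of the weights (divergence-free coefficients)
  have eq' : ∀ y, fderiv ℝ (fun y : PhaseSpace N => χ y * (y.2 b * f y)) y vq =
      y.2 b * partialQ b χ y * f y + χ y * (y.2 b * partialQ b f y) := fun y => by
    have hmf : DifferentiableAt ℝ (fun y : PhaseSpace N => y.2 b * f y) y := (hmd y).mul (hfd y)
    rw [← partialQ_eq_fderiv_apply b (hgqd y), partialQ_fun_mul b (hχd y) hmf,
      partialQ_fun_mul b (hmd y) (hfd y), partialQ_momentum_coord]
    ring
  have ep' : ∀ y, fderiv ℝ (fun y : PhaseSpace N => χ y * (a y.1 * f y)) y vp =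
      a y.1 * partialP b χ y * f y + χ y * (a y.1 * partialP b f y) := fun y => by
    have haf : DifferentiableAt ℝ (fun y : PhaseSpace N => a y.1 * f y) y := (had y).mul (hfd y)
    rw [← partialP_eq_fderiv_apply b (hgpd y), partialP_fun_mul b (hχd y) haf,
      partialP_fun_mul b (had y) (hfd y), partialP_fun_fst_eq_zero b a]
    ring
  -- split the left side
  have eL : (fun y => f y * (χ y * (y.2 b * partialQ b u y + a y.1 * partialP b u y))) =
      fun y => (χ y * (y.2 b * f y)) * fderiv ℝ u y vq +
        (χ y * (a y.1 * f y)) * fderiv ℝ u y vp := by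
    funext y
    rw [partialQ_eq_fderiv_apply b (hud y), partialP_eq_fderiv_apply b (hud y)]
    ring
  have iLq : Integrable (fun y => (χ y * (y.2 b * f y)) * fderiv ℝ u y vq)
      (volume : Measure (PhaseSpace N)) :=
    (hgqC.continuous.mul (hdu vq)).integrable_of_hasCompactSupport hgqc.mul_right
  have iLp : Integrable (fun y => (χ y * (a y.1 * f y)) * fderiv ℝ u y vp)
      (volume : Measure (PhaseSpace N)) :=
    (hgpC.continuous.mul (hdu vp)).integrable_of_hasCompactSupport hgpc.mul_right
  rw [eL, integral_add iLq iLp, hq, hp']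
  -- the four pieces on the right
  have hχ'q : Continuous (partialQ b χ) :=
    (contDiff_partialQ hχ (m := 0) (by exact_mod_cast le_rfl) b).continuous
  have hχ'p : Continuous (partialP b χ) := continuous_partialP_of_contDiff b hχ
  have hχ'qc : HasCompactSupport (partialQ b χ) := hasCompactSupport_partialQ hχd hχc b
  have hχ'pc : HasCompactSupport (partialP b χ) := hasCompactSupport_partialP hχd hχc b
  have hf'q : Continuous (partialQ b f) :=
    (contDiff_partialQ hf (m := 0) (by exact_mod_cast le_rfl) b).continuous
  have hf'p : Continuous (partialP b f) := continuous_partialP_of_contDiff b hf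
  have i1 : Integrable (fun y => y.2 b * partialQ b χ y * f y * u y)
      (volume : Measure (PhaseSpace N)) :=
    (((hmC.continuous.mul hχ'q).mul hf.continuous).mul
      hu.continuous).integrable_of_hasCompactSupport ((hχ'qc.mul_left.mul_right).mul_right)
  have i2 : Integrable (fun y => χ y * (y.2 b * partialQ b f y) * u y)
      (volume : Measure (PhaseSpace N)) :=
    ((hχ.continuous.mul (hmC.continuous.mul hf'q)).mul
      hu.continuous).integrable_of_hasCompactSupport (hχc.mul_right.mul_right)
  have i3 : Integrable (fun y => a y.1 * partialP b χ y * f y * u y)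
      (volume : Measure (PhaseSpace N)) :=
    (((haC.continuous.mul hχ'p).mul hf.continuous).mul
      hu.continuous).integrable_of_hasCompactSupport ((hχ'pc.mul_left.mul_right).mul_right)
  have i4 : Integrable (fun y => χ y * (a y.1 * partialP b f y) * u y)
      (volume : Measure (PhaseSpace N)) :=
    ((hχ.continuous.mul (haC.continuous.mul hf'p)).mul
      hu.continuous).integrable_of_hasCompactSupport (hχc.mul_right.mul_right)
  have eQ : (fun y => fderiv ℝ (fun y : PhaseSpace N => χ y * (y.2 b * f y)) y vq * u y) =
      fun y => y.2 b * partialQ b χ y * f y * u y + χ y * (y.2 b * partialQ b f y) * u y := by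
    funext y; rw [eq' y]; ring
  have eP : (fun y => fderiv ℝ (fun y : PhaseSpace N => χ y * (a y.1 * f y)) y vp * u y) =
      fun y => a y.1 * partialP b χ y * f y * u y + χ y * (a y.1 * partialP b f y) * u y := by
    funext y; rw [ep' y]; ring
  rw [eQ, eP, integral_add i1 i2, integral_add i3 i4]
  have e1 : ∫ y, u y * (f y * (y.2 b * partialQ b χ y + a y.1 * partialP b χ y)) =
      (∫ y, y.2 b * partialQ b χ y * f y * u y) + ∫ y, a y.1 * partialP b χ y * f y * u y := by
    rw [← integral_add i1 i3]
    exact integral_congr_ae (ae_of_all _ fun y => by ring)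
  have e2 : ∫ y, (χ y * (u y * y.2 b)) * partialQ b f y =
      ∫ y, χ y * (y.2 b * partialQ b f y) * u y :=
    integral_congr_ae (ae_of_all _ fun y => by ring)
  have e3 : ∫ y, (χ y * (u y * a y.1)) * partialP b f y =
      ∫ y, χ y * (a y.1 * partialP b f y) * u y :=
    integral_congr_ae (ae_of_all _ fun y => by ring)
  rw [e1, e2, e3]
  ring

end ByParts

end Summit.AtomisticToContinuum.FouriersLaw.Theorems.ExtensiveSnapshotIrreversibility.EnergyWindow

end
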